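/-
Copyright (c) 2026. Released under Apache 2.0 license as described in the file LICENSE.
Track B ∕ K2-LIT (cell `hodgecm-mathlib`, squad K2, ENGINE E1), crux h413 = `stmt-HodgeConjecture-24833`, route of record `HCCMUnconditional`.
Prover seat `hodgecm-mathlib-K2E3-p12` (g7).  Deal «P8 PROPER» (K2E1-plan (g5) 09:13:55Z), supplier of the letters `hα₁ hα₂ hα₂ne` of ★ `sphericalEisenstein_meromorphicOn_ball_of_letters` (sync line 09:34:07Z).
-/
import Summits.HodgeConjecture.HodgeConjecture.Theorems.K2E1BLHeightPowerHolomorphicU2      -- ★ ℓ7 (this seat): `memLp_borelQuotHeight_rpow_add_rpow`, `norm_ofReal_cpow_le_rpow_add_rpow`, `borelQuotHeight_pos`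
import HarnessLib

/-!
# K2·E1 — `K2E1BLConstantTermVectorsU2`: BERNSTEIN–LAPID'S CONSTANT-TERM VECTORS `α₁(z) = [H^z]`, `α₂(z) = [H^{1−z}]` EXIST IN `𝓗_k(Z_c)` ON EVERY BALL `ball 0 (n + 2)` WITH `n + 3 ≤ k`, IN THE
# `=ᵐ` CURRENCY, AND ARE NON-ZERO [arXiv:1911.02342, §4 p. 10: «N = 1 + sup |Re s| … then α₁(s), α₂(s) ∈ 𝓗_N(Z_c) and are linearly independent»]

Track B ∕ K2-LIT, crux h413 = `stmt-HodgeConjecture-24833`, route of record `HCCMUnconditional`; cell `hodgecm-mathlib`, squad K2, ENGINE E1 (campaign EIS-R7-BL-SPH-2, P8 PROPER; sync line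
09:34:07Z: the S-file (K2E4-p23), P6′ (K2E1-p02) and the closer all take `α₁ α₂` ABSTRACT with `=ᵐ` letters — this file is the one supplier).  Prover seat `hodgecm-mathlib-K2E3-p12` (g7).
THEOREMS ONLY (no `def`, no `instance`, no notation, no named-fact hypothesis, no `sorry`); lane `--supports stmt-HodgeConjecture-24833 --as helper` (count-neutral).  Closes no socket.
RANK-GENERIC.
§1 **`memLp_borelQuotHeight_cpow`** (`x ↦ (H x)^w ∈ 𝓗_k(Z_c)` for `σ₀ ≤ Re w ≤ σ₁`, `σ₀, σ₁ ≤ k`, `μZ(Z_c) < ∞`).  §2 **`exists_HN_ae_eq_cpow`** (a map `α : ℂ → 𝓗_k(Z_c)` with `α z =ᵐ H^{φ z}` on any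
set where `σ₀ ≤ Re φ ≤ σ₁`).  §3 **`ne_zero_of_ae_eq_cpow`** (`α =ᵐ H^w ⟹ α ≠ 0` once `μZ(Z_c) ≠ 0`: `H^w` vanishes nowhere).  §4 **`exists_constantTermVectors`** — THE PACKAGE on `ball 0 (n + 2)`, `n + 3 ≤ k`:
`∃ α₁ α₂`, `α₁ z =ᵐ H^z`, `α₂ z =ᵐ H^{1−z}`, `α₁ z ≠ 0`, `α₂ z ≠ 0` — exactly the letters `hα₁ hα₂ hα₂ne` of ★ P8 §2.
HONEST LABEL: HC_CM is proved only modulo the 7 printed citations (2 remaining named inputs: hLiu418 = `stmt-HodgeConjecture-24832`, h413 = `stmt-HodgeConjecture-24833`) until rung 0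
closes; this file asserts no named fact and closes no socket.
References: [BernsteinLapid2019] J. Bernstein, E. Lapid, *On the meromorphic continuation of Eisenstein series*, arXiv:1911.02342 (JAMS 37 (2024), doi:10.1090/jams/1020), §4 p. 10.
-/

set_option autoImplicit false
-- the mandated namespace repeats the single-problem summit's segment (`HodgeConjecture.HodgeConjecture`)
set_option linter.dupNamespace false

noncomputable section

open MeasureTheory Filter Topology Set NumberField
open scoped NNReal ENNReal Classical
open Literature.NumberTheory.Automorphic Literature.NumberTheory.Automorphic.UnitaryGroup
open Summit.HodgeConjecture.HodgeConjecture.Cruxes.H413.K2E1BLBorelSpacesU2Defs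
open Summit.HodgeConjecture.HodgeConjecture.Cruxes.H413.K2E1BLIotaUnfoldingU (measurable_borelQuotHeight)
open Summit.HodgeConjecture.HodgeConjecture.Cruxes.H413.K2E1BLHeightPowerHolomorphicU2 (memLp_borelQuotHeight_rpow_add_rpow norm_ofReal_cpow_le_rpow_add_rpow borelQuotHeight_pos)

namespace Summit.HodgeConjecture.HodgeConjecture.Cruxes.H413.K2E1BLConstantTermVectorsU2

variable {F E : Type} [Field F] [NumberField F] [Field E] [NumberField E] [Algebra F E] {c : E ≃ₐ[F] E} {N : ℕ} [NeZero N]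
variable {k : ℕ} {c₁ : ℝ≥0} {μZ : Measure (borelQuotient F E c N)}

/-! ## §1 `H^w ∈ 𝓗_k(Z_c)` -/

/-- **`x ↦ (H x)^w ∈ 𝓗_k(Z_c)`** for `σ₀ ≤ Re w ≤ σ₁` with `σ₀, σ₁ ≤ k` and `μZ(Z_c) < ∞` (dominated by `H^{σ₀} + H^{σ₁} ∈ 𝓗_k(Z_c)`, ★ ℓ7). [cite: BernsteinLapid2019, §4 p. 10] -/
theorem memLp_borelQuotHeight_cpow (hc₁ : 0 < c₁) (hfin : μZ {z | c₁ < borelQuotHeight F E c N z} ≠ ∞) {σ₀ σ₁ : ℝ} (hσ₀ : σ₀ ≤ k) (hσ₁ : σ₁ ≤ k) {w : ℂ} (hw : σ₀ ≤ w.re ∧ w.re ≤ σ₁) :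
    MemLp (fun x => (((borelQuotHeight F E c N x : ℝ≥0) : ℝ) : ℂ) ^ w) 2 (weightedTruncMeasure F E c N k c₁ μZ) := by
  refine (memLp_borelQuotHeight_rpow_add_rpow hc₁ hfin hσ₀ hσ₁).of_le ((Complex.measurable_ofReal.comp measurable_borelQuotHeight.coe_nnreal_real).pow_const w).aestronglyMeasurable
    (Eventually.of_forall fun x => ?_)
  rw [Real.norm_of_nonneg (by positivity)]
  exact norm_ofReal_cpow_le_rpow_add_rpow (borelQuotHeight_pos x) hw.1 hw.2

/-! ## §2 A vector-valued map with prescribed a.e. values -/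

/-- **THERE IS `α : ℂ → 𝓗_k(Z_c)` WITH `α z =ᵐ H^{φ(z)}`** on any set `U` where `σ₀ ≤ Re φ ≤ σ₁` (`σ₀, σ₁ ≤ k`, `μZ(Z_c) < ∞`): the class of `H^{φ z}` where it is square integrable, `0` elsewhere. [cite: BernsteinLapid2019, §4 p. 10] -/
theorem exists_HN_ae_eq_cpow (hc₁ : 0 < c₁) (hfin : μZ {z | c₁ < borelQuotHeight F E c N z} ≠ ∞) {σ₀ σ₁ : ℝ} (hσ₀ : σ₀ ≤ k) (hσ₁ : σ₁ ≤ k) (φ : ℂ → ℂ) {U : Set ℂ}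
    (hφre : ∀ z ∈ U, σ₀ ≤ (φ z).re ∧ (φ z).re ≤ σ₁) :
    ∃ α : ℂ → HN F E c N k c₁ μZ, ∀ z ∈ U, (α z : borelQuotient F E c N → ℂ) =ᵐ[weightedTruncMeasure F E c N k c₁ μZ] fun x => (((borelQuotHeight F E c N x : ℝ≥0) : ℝ) : ℂ) ^ φ z := by
  refine ⟨fun z => if h : σ₀ ≤ (φ z).re ∧ (φ z).re ≤ σ₁ then (memLp_borelQuotHeight_cpow hc₁ hfin hσ₀ hσ₁ h).toLp _ else 0, fun z hz => ?_⟩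
  simp only [dif_pos (hφre z hz)]
  exact MemLp.coeFn_toLp _

/-! ## §3 Non-vanishing -/

/-- The weighted truncated measure is non-zero as soon as `μZ(Z_c) ≠ 0` (its density `H^{−2k}` vanishes nowhere). [cite: BernsteinLapid2019, §4 p. 10] -/
theorem weightedTruncMeasure_ne_zero (hne : μZ {z | c₁ < borelQuotHeight F E c N z} ≠ 0) : weightedTruncMeasure F E c N k c₁ μZ ≠ 0 := by
  intro h0
  have hdNN : Measurable fun z : borelQuotient F E c N => ((borelQuotHeight F E c N z)⁻¹ ^ (2 * k) : ℝ≥0) := measurable_borelQuotHeight.inv.pow_const _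
  rw [weightedTruncMeasure, withDensity_eq_zero_iff hdNN.coe_nnreal_ennreal.aemeasurable] at h0
  have hfalse : ∀ᵐ z ∂(μZ.restrict {z | c₁ < borelQuotHeight F E c N z}), False := by
    filter_upwards [h0] with z hz
    rw [Pi.zero_apply, ENNReal.coe_eq_zero] at hz
    have hpos : 0 < (borelQuotHeight F E c N z)⁻¹ ^ (2 * k) := pow_pos (inv_pos.2 (by exact_mod_cast borelQuotHeight_pos z)) _
    exact absurd hz hpos.ne'
  rw [eventually_false_iff_eq_bot, ae_eq_bot, Measure.restrict_eq_zero] at hfalse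
  exact hne hfalse

/-- **`α =ᵐ H^w ⟹ α ≠ 0`** in `𝓗_k(Z_c)` once `μZ(Z_c) ≠ 0` (`H^w` vanishes nowhere). [cite: BernsteinLapid2019, §4 p. 10 («linearly independent», in particular non-zero)] -/
theorem ne_zero_of_ae_eq_cpow (hne : μZ {z | c₁ < borelQuotHeight F E c N z} ≠ 0) {α : HN F E c N k c₁ μZ} {w : ℂ}
    (hα : (α : borelQuotient F E c N → ℂ) =ᵐ[weightedTruncMeasure F E c N k c₁ μZ] fun x => (((borelQuotHeight F E c N x : ℝ≥0) : ℝ) : ℂ) ^ w) : α ≠ 0 := by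
  intro h0
  rw [Lp.eq_zero_iff_ae_eq_zero] at h0
  have hfalse : ∀ᵐ z ∂(weightedTruncMeasure F E c N k c₁ μZ), False := by
    filter_upwards [hα, h0] with z h1 h2
    rw [h1, Pi.zero_apply] at h2
    have hpos : (0 : ℝ) < ((borelQuotHeight F E c N z : ℝ≥0) : ℝ) := borelQuotHeight_pos z
    exact (Complex.ofReal_ne_zero.2 hpos.ne') ((Complex.cpow_eq_zero_iff _ _).1 h2).1
  rw [eventually_false_iff_eq_bot, ae_eq_bot] at hfalse
  exact weightedTruncMeasure_ne_zero hne hfalse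

/-! ## §4 The package on a ball -/

/-- **THE CONSTANT-TERM VECTORS ON `ball 0 (n + 2)`** (`n + 3 ≤ k`, `μZ(Z_c)` finite and non-zero): `∃ α₁ α₂ : ℂ → 𝓗_k(Z_c)` with `α₁ z =ᵐ H^z`, `α₂ z =ᵐ H^{1−z}`, both non-zero, for every `z` in the ball —
exactly the letters `hα₁ hα₂ hα₂ne` of ★ `sphericalEisenstein_meromorphicOn_ball_of_letters`. [cite: BernsteinLapid2019, §4 p. 10] -/
theorem exists_constantTermVectors (n : ℕ) (hk : (n : ℝ) + 3 ≤ k) (hc₁ : 0 < c₁) (hfin : μZ {z | c₁ < borelQuotHeight F E c N z} ≠ ∞) (hne : μZ {z | c₁ < borelQuotHeight F E c N z} ≠ 0) :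
    ∃ α₁ α₂ : ℂ → HN F E c N k c₁ μZ,
      (∀ z ∈ Metric.ball (0 : ℂ) (n + 2), (α₁ z : borelQuotient F E c N → ℂ) =ᵐ[weightedTruncMeasure F E c N k c₁ μZ] fun x => (((borelQuotHeight F E c N x : ℝ≥0) : ℝ) : ℂ) ^ z) ∧
      (∀ z ∈ Metric.ball (0 : ℂ) (n + 2), (α₂ z : borelQuotient F E c N → ℂ) =ᵐ[weightedTruncMeasure F E c N k c₁ μZ] fun x => (((borelQuotHeight F E c N x : ℝ≥0) : ℝ) : ℂ) ^ (1 - z)) ∧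
      (∀ z ∈ Metric.ball (0 : ℂ) (n + 2), α₁ z ≠ 0) ∧ (∀ z ∈ Metric.ball (0 : ℂ) (n + 2), α₂ z ≠ 0) := by
  have hre : ∀ z ∈ Metric.ball (0 : ℂ) (n + 2), |z.re| < n + 2 := fun z hz =>
    lt_of_le_of_lt (Complex.abs_re_le_norm z) (by rwa [Metric.mem_ball, dist_zero_right] at hz)
  obtain ⟨α₁, hα₁⟩ := exists_HN_ae_eq_cpow (k := k) hc₁ hfin (σ₀ := -((n : ℝ) + 2)) (σ₁ := (n : ℝ) + 2) (by linarith) (by linarith) (fun z : ℂ => z)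
    (U := Metric.ball (0 : ℂ) (n + 2)) fun z hz => ⟨by linarith [(abs_lt.1 (hre z hz)).1], by linarith [(abs_lt.1 (hre z hz)).2]⟩
  obtain ⟨α₂, hα₂⟩ := exists_HN_ae_eq_cpow (k := k) hc₁ hfin (σ₀ := -((n : ℝ) + 1)) (σ₁ := (n : ℝ) + 3) (by linarith) (by linarith) (fun z : ℂ => 1 - z)
    (U := Metric.ball (0 : ℂ) (n + 2)) fun z hz => by
      simp only [Complex.sub_re, Complex.one_re]
      exact ⟨by linarith [(abs_lt.1 (hre z hz)).2], by linarith [(abs_lt.1 (hre z hz)).1]⟩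
  exact ⟨α₁, α₂, hα₁, hα₂, fun z hz => ne_zero_of_ae_eq_cpow hne (hα₁ z hz), fun z hz => ne_zero_of_ae_eq_cpow hne (hα₂ z hz)⟩

end Summit.HodgeConjecture.HodgeConjecture.Cruxes.H413.K2E1BLConstantTermVectorsU2

end
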